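import Mathlib
import Summits.ValiantsHypothesis.ValiantsHypothesis.Theorems.LacunarySymmetroidMatrixDescartesTieLawBoundarySum
import Summits.ValiantsHypothesis.ValiantsHypothesis.Theorems.LacunarySymmetroidMatrixDescartesTieLawTrinomial
import HarnessLib

/-!
# ValiantsHypothesis / LacunarySymmetroid — crux `MatrixDescartes` (stmt-ValiantsHypothesis-18050, V1), LINE (A) «product_plus_one»:
# the TIE LAW, kernel path Stage 2, part 5a — tie-sector geometry and the two roots of `q` in `S′`

Preparations for the induction on the number of wells (pen val-idea-25 g8, HOME NOTE §45.3–45.4): the tie sector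
`S′ = tieSector c` and its exterior are open and disjoint, their complement is the two closed rays (`eq_ray_of_not_mem_tie`);
the rotations `ρ ↦ ω̄ρ`, `ρ ↦ ωρ` carry `trinSector` (resp. its conjugate) onto `S′`, whence `#{roots of q in S′} = 2`
(`card_roots_qPoly_tieSector`, from (I5) `card_roots_gPoly_trinSector` and (I1) `roots_map_qPoly`).  Degrees, the splitting
identity, the base case and the location of the roots of `M_F` are in `…TieLawDegrees`.
HONEST FRAMING: helper lemmas; no stub of LINE (A) is touched; `MatrixDescartes` OPEN; `VP ≠ VNP` is NOT proved.  No definitions,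
no named facts.
-/

set_option linter.dupNamespace false

namespace Summit.ValiantsHypothesis.ValiantsHypothesis.Theorems.LacunarySymmetroidMatrixDescartes

namespace TieLaw

open Polynomial Filter Topology

section Count

variable {a b c : ℕ} {β γ : ℝ}

/-! ### The tie sector -/

/-- `S′` is open. -/
theorem isOpen_tieSector (c : ℕ) : IsOpen (tieSector c) := by
  have h1 : IsOpen {z : ℂ | 0 < (z * rot (Real.pi / c)).im} :=
    isOpen_lt continuous_const (Complex.continuous_im.comp (continuous_id.mul continuous_const))
  have h2 : IsOpen {z : ℂ | (z * rot (-(Real.pi / c))).im < 0} :=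
    isOpen_lt (Complex.continuous_im.comp (continuous_id.mul continuous_const)) continuous_const
  exact h1.inter h2

/-- The exterior of `S′` is open. -/
theorem isOpen_tieExterior (c : ℕ) : IsOpen (tieExterior c) := by
  have h1 : IsOpen {z : ℂ | (z * rot (Real.pi / c)).im < 0} :=
    isOpen_lt (Complex.continuous_im.comp (continuous_id.mul continuous_const)) continuous_const
  have h2 : IsOpen {z : ℂ | 0 < (z * rot (-(Real.pi / c))).im} :=
    isOpen_lt continuous_const (Complex.continuous_im.comp (continuous_id.mul continuous_const))
  exact h1.union h2

/-- `S′` and its exterior are disjoint. -/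
theorem not_mem_tieSector_of_mem_tieExterior {c : ℕ} {z : ℂ} (hz : z ∈ tieExterior c) : z ∉ tieSector c := by
  rw [mem_tieExterior] at hz
  rw [mem_tieSector]
  rintro ⟨h1, h2⟩
  rcases hz with h | h <;> linarith

/-- `S′` and its exterior are disjoint (set form). -/
theorem disjoint_tieSector_tieExterior (c : ℕ) : Disjoint (tieSector c) (tieExterior c) :=
  Set.disjoint_left.2 fun _ hz hE => not_mem_tieSector_of_mem_tieExterior hE hz

/-- Off `S′` and its exterior, a point lies on one of the two closed boundary rays. -/
theorem boundary_of_not_mem_tie {c : ℕ} {z : ℂ} (h1 : z ∉ tieSector c) (h2 : z ∉ tieExterior c) :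
    ((z * rot (-(Real.pi / c))).im = 0 ∧ 0 ≤ (z * rot (Real.pi / c)).im) ∨
      ((z * rot (Real.pi / c)).im = 0 ∧ (z * rot (-(Real.pi / c))).im ≤ 0) := by
  rw [mem_tieSector, not_and_or] at h1
  rw [mem_tieExterior, not_or] at h2
  obtain ⟨h2a, h2b⟩ := h2
  push Not at h2a h2b
  rcases h1 with h | h
  · push Not at h
    exact Or.inr ⟨le_antisymm h h2a, h2b⟩
  · push Not at h
    exact Or.inl ⟨le_antisymm h2b h, h2a⟩

/-- A point of a closed boundary ray of `S′` is `0` or `t e^{±iπ/c}` with `t > 0` (`c > 2`). -/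
theorem eq_ray_of_not_mem_tie {c : ℕ} (hc : 2 < c) {z : ℂ} (h1 : z ∉ tieSector c) (h2 : z ∉ tieExterior c)
    (hz : z ≠ 0) :
    ∃ t : ℝ, 0 < t ∧ (z = (t : ℂ) * rot (Real.pi / c) ∨ z = (t : ℂ) * rot (-(Real.pi / c))) := by
  have hsin : 0 < Real.sin (2 * Real.pi / c) := sin_two_pi_div_pos hc
  rcases boundary_of_not_mem_tie h1 h2 with ⟨hq, hp⟩ | ⟨hp, hq⟩
  · -- z = u ω
    have hzu := eq_ofReal_mul_rot_of_im_eq_zero hq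
    set u := (z * rot (-(Real.pi / c))).re
    have hp' : 0 ≤ u * Real.sin (2 * Real.pi / c) := by
      rw [hzu, mul_assoc, rot_pi_div_mul_self, im_ofReal_mul_rot] at hp
      exact hp
    have hu : 0 ≤ u := by nlinarith
    rcases hu.eq_or_lt with h | h
    · exfalso; apply hz; rw [hzu, ← h]; simp
    · exact ⟨u, h, Or.inl hzu⟩
  · -- z = u ω̄
    have hq' : (z * rot (-(-(Real.pi / c)))).im = 0 := by rw [neg_neg]; exact hp
    have hzu := eq_ofReal_mul_rot_of_im_eq_zero hq'
    set u := (z * rot (-(-(Real.pi / c)))).re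
    have hp' : u * Real.sin (-(2 * Real.pi / c)) ≤ 0 := by
      rw [hzu, mul_assoc, ← rot_add, show -(Real.pi / c) + -(Real.pi / c) = -(2 * Real.pi / c) by ring,
        im_ofReal_mul_rot] at hq
      exact hq
    rw [Real.sin_neg] at hp'
    have hu : 0 ≤ u := by nlinarith
    rcases hu.eq_or_lt with h | h
    · exfalso; apply hz; rw [hzu, ← h]; simp
    · exact ⟨u, h, Or.inr hzu⟩

/-- `ω̄ρ ∈ S′ ↔ ρ ∈ trinSector c`. -/
theorem omegaBar_mul_mem_tieSector {c : ℕ} (ρ : ℂ) :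
    rot (-(Real.pi / c)) * ρ ∈ tieSector c ↔ ρ ∈ trinSector c := by
  have e1 : rot (-(Real.pi / c)) * ρ * rot (Real.pi / c) = ρ := by
    rw [mul_comm (rot _) ρ, mul_assoc, rot_neg_mul_rot, mul_one]
  have e2 : rot (-(Real.pi / c)) * ρ * rot (-(Real.pi / c)) = ρ * rot (-(2 * Real.pi / c)) := by
    rw [mul_comm (rot _) ρ, mul_assoc, ← rot_add]
    congr 2
    ring
  rw [mem_tieSector, mem_trinSector, e1, e2]

/-- `ωρ ∈ S′ ↔ conj ρ ∈ trinSector c`. -/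
theorem omega_mul_mem_tieSector {c : ℕ} (ρ : ℂ) :
    rot (Real.pi / c) * ρ ∈ tieSector c ↔ (starRingEnd ℂ) ρ ∈ trinSector c := by
  have e1 : rot (Real.pi / c) * ρ * rot (Real.pi / c) = ρ * rot (2 * Real.pi / c) := by
    rw [mul_comm (rot _) ρ, mul_assoc, rot_pi_div_mul_self]
  have e2 : rot (Real.pi / c) * ρ * rot (-(Real.pi / c)) = ρ := by
    rw [mul_comm (rot _) ρ, mul_assoc, rot_mul_rot_neg, mul_one]
  have e3 : ((starRingEnd ℂ) ρ * rot (-(2 * Real.pi / c))).im = -(ρ * rot (2 * Real.pi / c)).im := by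
    rw [← conj_rot, ← map_mul, Complex.conj_im]
  rw [mem_tieSector, mem_trinSector, e1, e2, e3, Complex.conj_im]
  constructor
  · rintro ⟨h1, h2⟩; exact ⟨by linarith, by linarith⟩
  · rintro ⟨h1, h2⟩; exact ⟨by linarith, by linarith⟩

open Classical in
/-- **Two roots of `q` in `S′`**: for `0 < a < b`, `c = a + b`, `β, γ > 0`, `q` has exactly two complex roots, counted with
multiplicity, in the tie sector (one from each rotated copy of `g`, by (I5)). -/
theorem card_roots_qPoly_tieSector (ha : 0 < a) (hab : a < b) (hβ : 0 < β) (hγ : 0 < γ) :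
    ((((qPoly a (a + b) β γ).map (algebraMap ℝ ℂ)).roots.filter (· ∈ tieSector (a + b))).card) = 2 := by
  have hac : a < a + b := by omega
  have h2a : 2 * a < a + b := by omega
  have hone := card_roots_gPoly_trinSector (c := a + b) ha h2a hβ hγ
  rw [roots_map_qPoly ha hac β hγ.ne', Multiset.filter_add, Multiset.card_add, Multiset.filter_map,
    Multiset.card_map, Multiset.filter_map, Multiset.card_map]
  have e1 : ((gPoly a (a + b) β γ).map (algebraMap ℝ ℂ)).roots.filter
      ((fun x => x ∈ tieSector (a + b)) ∘ fun ρ => rot (-(Real.pi / (a + b : ℕ))) * ρ) =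
      ((gPoly a (a + b) β γ).map (algebraMap ℝ ℂ)).roots.filter (· ∈ trinSector (a + b)) :=
    Multiset.filter_congr fun ρ _ => by simp only [Function.comp]; exact omegaBar_mul_mem_tieSector ρ
  have e2 : (((gPoly a (a + b) β γ).map (algebraMap ℝ ℂ)).roots.filter
      ((fun x => x ∈ tieSector (a + b)) ∘ fun ρ => rot (Real.pi / (a + b : ℕ)) * ρ)).card =
      (((gPoly a (a + b) β γ).map (algebraMap ℝ ℂ)).roots.filter (· ∈ trinSector (a + b))).card := by
    conv_rhs => rw [← Literature.Analysis.Complex.Pellet.roots_map_conj (gPoly a (a + b) β γ)]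
    rw [Multiset.filter_map, Multiset.card_map]
    congr 1
    exact Multiset.filter_congr fun ρ _ => by simp only [Function.comp]; exact omega_mul_mem_tieSector ρ
  rw [e1, e2, hone]

end Count

end TieLaw

end Summit.ValiantsHypothesis.ValiantsHypothesis.Theorems.LacunarySymmetroidMatrixDescartes
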